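import Literature.NumberTheory.GaloisRepresentations.RamificationGalois
import Mathlib.RingTheory.DedekindDomain.Ideal.Lemmas
import Mathlib.FieldTheory.Finite.Basic
import Mathlib.Algebra.Ring.GeomSum
import Mathlib.RingTheory.Frobenius
import Mathlib.RingTheory.IntegralDomain
import Mathlib.GroupTheory.Exponent
import HarnessLib

/-!
# The successive quotients of the ramification filtration

Let a group `G` act on a Dedekind domain `S` by ring automorphisms and let `Q` be a nonzero
maximal ideal of `S` with finite residue field `κ(Q) = S/Q` of characteristic `p`.  For the
lower-numbering ramification groups `G_m = Q.ramificationSubgroup G m`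
(`RamificationFiltration.lean`: `G_m = {σ ∈ D_Q | ∀ x, σ x ≡ x (mod Q^{m+1})}`, `G_0 = I_Q`) we
prove the classical description of the successive quotients, following Marcus, *Number Fields*
(2nd ed. 2018), Ch. 4, Exercises 19–23 (pp. 98–100 of the held copy):

* `mem_ramificationSubgroup_succ_iff`, `mem_ramificationSubgroup_iff_smul_sub_mem` (Ex. 19–20):
  for `π ∈ Q \ Q²` and `σ ∈ G_m`, `σ ∈ G_{m+1} ↔ σ π ≡ π (mod Q^{m+2})`; hence for `σ ∈ G_0`,
  `σ ∈ G_m ↔ σ π ≡ π (mod Q^{m+1})`.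
* `exists_monoidHom_ramificationSubgroup_zero_units` (Ex. 21): a homomorphism
  `θ₀ : G_0 → κ(Q)ˣ`, `σ ↦ ā` where `σ π ≡ a π (mod Q²)`, with kernel `G_1`.
* `exists_monoidHom_ramificationSubgroup_multiplicative` (Ex. 22): for `m ≥ 1` a homomorphism
  `θ_m : G_m → (κ(Q), +)`, `σ ↦ ā` where `σ π ≡ π + a π^{m+1} (mod Q^{m+2})`, with kernel `G_{m+1}`.
* Consequences: `[G_0 : G_1] ∣ #κ(Q) - 1` (so it is prime to `p`),
  `[G_m : G_{m+1}] ∣ #κ(Q)` and `σ ∈ G_m ⇒ σ^p ∈ G_{m+1}` for `m ≥ 1` (Ex. 21(c), 22(c));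
  that `G_1` is a `p`-group (Ex. 23) is the tree's `Ideal.isPGroup_ramificationSubgroup_one`
  (`TameInertiaProofs.lean`).
* `relIndex_ramificationSubgroup_one_dvd_of_commute` (Ex. 26(c)): if the decomposition group
  centralises the inertia group (e.g. `G` abelian) then `[G_0 : G_1] ∣ #κ(𝔭) - 1`, `𝔭 = Q ∩ R`
  for the ring of invariants `R` — by the Frobenius rationality `θ₀(σ) ∈ κ(𝔭)` obtained from a
  Frobenius element (Mathlib `IsArithFrobAt.exists_of_isInvariant`).

These are the inputs "`V_1 = E`, `#(V_{m-1}/V_m) ≤ p` when `f = 1`" and "`e ∣ q - 1`" of the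
Hilbert–Speiser proof of the Kronecker–Weber theorem (Marcus, Ch. 4, Ex. 31(b), 34(b)–(c)).

Related results already in the tree: the uniformizer criterion under the hypothesis of
`σ`-fixed representatives (`mem_ramificationSubgroup_iff_smul_sub_mem_pow`,
`RamificationGalois.lean`, Serre IV §1 Lemma 1), and `θ₀` with its kernel
(`exists_inertia_hom_units_ker_eq`, `ArtinConductorWildProofs.lean`); the versions here assume
only a finite residue field and record the defining formula of `θ₀`, which Ex. 26 needs.

## Proof notes (as formalised)

Marcus proves Ex. 19(c) via `S = S_E + Q` (the inertia field); we use instead the finite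
residue field directly: for `x ∈ S` and `N = #κ(Q)`, `x^N ≡ x (mod Q)` and
`σ(x^N) - x^N = (σ x - x) · g` with `g = Σ (σ x)^i x^{N-1-i} ≡ N x^{N-1} ≡ 0 (mod Q)`, so that
`(σ x - x)(1 - g) ∈ Q^{m+2}` with `1 - g ∉ Q`.  The uniformizer bookkeeping
(`Q^k = (π^k) + Q^{k+1}`, `a π^k ∈ Q^{k+1} ⇒ a ∈ Q`) comes from `RamificationGalois.lean`
(`exists_eq_pow_mul_add_of_mem_pow`, the order `ord Q`).  The maps `θ₀`, `θ_m` are produced existentially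
(with their defining property and kernel), to keep this file free of new definitions.

## References

* [Marcus2018] D. A. Marcus, *Number Fields*, 2nd ed., Universitext, Springer (2018), Ch. 4,
  Exercises 19–23, 26 (pp. 98–100).
* J.-P. Serre, *Local Fields*, GTM 67, Ch. IV §1 Prop. 1, §2 Props. 5–7 (the local case).
-/

noncomputable section

open Ideal UniqueFactorizationMonoid
open scoped Pointwise

namespace Literature.NumberTheory.GaloisRepresentations

variable {S : Type*} [CommRing S] [IsDedekindDomain S]
variable {G : Type*} [Group G] [MulSemiringAction G S]
variable {Q : Ideal S}

/-! ### Uniformizers: `π ∈ Q \ Q²` (complements to `RamificationGalois.lean`) -/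

section Uniformizer

variable [Q.IsMaximal]

/-- For `π ∈ Q \ Q²` (`Q ≠ 0` maximal in a Dedekind domain): every `x ∈ Q ^ k` is
`≡ a π^k (mod Q^(k+1))` for some `a` — a repackaging of the tree's
`exists_eq_pow_mul_add_of_mem_pow` (`Q^k = (π^k) + Q^(k+1)`). [folklore] -/
theorem exists_sub_mul_pow_mem_pow_succ (hQ : Q ≠ ⊥) {π : S} (hπ : π ∈ Q) (hπ2 : π ∉ Q ^ 2)
    {k : ℕ} {x : S} (hx : x ∈ Q ^ k) : ∃ a : S, x - a * π ^ k ∈ Q ^ (k + 1) := by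
  obtain ⟨d, c', hc', rfl⟩ := exists_eq_pow_mul_add_of_mem_pow Q hQ hπ hπ2 hx
  exact ⟨d, by simpa [mul_comm] using hc'⟩

/-- For `π ∈ Q \ Q²`: if `a π^k ∈ Q^(k+1)` then `a ∈ Q` (uniqueness of the coefficient `a`
modulo `Q` in `x ≡ a π^k`), by `v_Q(a π^k) = v_Q(a) + k`. [folklore] -/
theorem mem_of_mul_pow_mem_pow_succ (hQ : Q ≠ ⊥) {π : S} (hπ : π ∈ Q) (hπ2 : π ∉ Q ^ 2)
    {k : ℕ} {a : S} (h : a * π ^ k ∈ Q ^ (k + 1)) : a ∈ Q := by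
  have h1 := (mem_pow_iff_le_ord Q).mp h
  rw [ord_mul Q hQ, ord_pow Q hQ, ord_eq_one Q hπ hπ2, mul_one, Nat.cast_add, Nat.cast_one]
    at h1
  have h2 : (1 : ℕ∞) ≤ ord Q a := by
    have hk : (k : ℕ∞) ≠ ⊤ := ENat.coe_ne_top k
    rw [add_comm (k : ℕ∞) 1] at h1
    exact (ENat.add_le_add_iff_right hk).mp h1
  rw [← pow_one Q, mem_pow_iff_le_ord Q]
  exact_mod_cast h2

end Uniformizer

/-! ### Membership in `G_{m+1}` is tested on a uniformizer -/

section Filtration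

variable [Q.IsMaximal]

omit [IsDedekindDomain S] [Q.IsMaximal] in
/-- If `σ ∈ G_m` then `σ • (y z) - y z ∈ Q^(m+2)` for `y, z ∈ Q`. [folklore] -/
theorem smul_sub_mem_pow_of_mem_mul {m : ℕ} {σ : G} (hσ : σ ∈ Q.ramificationSubgroup G m)
    {x : S} (hx : x ∈ Q * Q) : σ • x - x ∈ Q ^ (m + 2) := by
  refine Submodule.mul_induction_on hx (fun y hy z hz => ?_) (fun x y hx hy => ?_)
  · have h1 : σ • (y * z) - y * z = (σ • y - y) * (σ • z) + y * (σ • z - z) := by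
      rw [smul_mul']; ring
    rw [h1, pow_succ]
    refine Ideal.add_mem _ (Ideal.mul_mem_mul (hσ.2 y) ?_) ?_
    · simpa using Ideal.add_mem _ (Ideal.pow_le_self (Nat.succ_ne_zero m) (hσ.2 z)) hz
    · rw [mul_comm y]
      exact Ideal.mul_mem_mul (hσ.2 z) hy
  · have h1 : σ • (x + y) - (x + y) = (σ • x - x) + (σ • y - y) := by rw [smul_add]; ring
    rw [h1]
    exact Ideal.add_mem _ hx hy

/-- **Marcus, Ch. 4, Ex. 19.**  Let `Q` be a nonzero maximal ideal of the Dedekind domain `S`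
with finite residue field, `π ∈ Q \ Q²`, and `σ ∈ G_m` (`m ≥ 0`).  Then `σ ∈ G_{m+1}` iff
`σ π ≡ π (mod Q^{m+2})`. [cite: Marcus2018, Ch. 4, Ex. 19–20 (pp. 98–99)] -/
theorem mem_ramificationSubgroup_succ_iff [Finite (S ⧸ Q)] (hQ : Q ≠ ⊥) {π : S} (hπ : π ∈ Q)
    (hπ2 : π ∉ Q ^ 2) {m : ℕ} {σ : G} (hσ : σ ∈ Q.ramificationSubgroup G m) :
    σ ∈ Q.ramificationSubgroup G (m + 1) ↔ σ • π - π ∈ Q ^ (m + 2) := by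
  refine ⟨fun h => h.2 π, fun hπσ => ⟨hσ.1, fun x => ?_⟩⟩
  -- (b): elements of `Q`
  have hb : ∀ x ∈ Q, σ • x - x ∈ Q ^ (m + 2) := by
    intro x hx
    obtain ⟨a, hz⟩ := exists_sub_mul_pow_mem_pow_succ hQ hπ hπ2 (k := 1) (by simpa using hx)
    have h1 : σ • x - x = (σ • a - a) * (σ • π) + a * (σ • π - π) +
        (σ • (x - a * π ^ 1) - (x - a * π ^ 1)) := by
      rw [smul_sub, smul_mul', smul_pow']; ring
    rw [h1]
    refine Ideal.add_mem _ (Ideal.add_mem _ ?_ (Ideal.mul_mem_left _ _ hπσ)) ?_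
    · rw [pow_succ]
      refine Ideal.mul_mem_mul (hσ.2 a) ?_
      simpa using Ideal.add_mem _ (Ideal.pow_le_self (Nat.succ_ne_zero m) (hσ.2 π)) hπ
    · exact smul_sub_mem_pow_of_mem_mul hσ (by simpa [pow_two] using hz)
  -- (c): general elements, via `x ^ #κ ≡ x (mod Q)`
  classical
  letI : Field (S ⧸ Q) := Ideal.Quotient.field Q
  haveI : Fintype (S ⧸ Q) := Fintype.ofFinite _
  set N := Fintype.card (S ⧸ Q) with hN
  have hxN : x ^ N - x ∈ Q := by
    rw [← Ideal.Quotient.eq_zero_iff_mem, map_sub, map_pow, FiniteField.pow_card, sub_self]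
  -- the cofactor `Σ (σ x)^i x^(N-1-i)` lies in `Q`
  have hg : (∑ i ∈ Finset.range N, (σ • x) ^ i * x ^ (N - 1 - i)) ∈ Q := by
    rw [← Ideal.Quotient.eq_zero_iff_mem, map_sum]
    have hσx : Ideal.Quotient.mk Q (σ • x) = Ideal.Quotient.mk Q x := by
      rw [Ideal.Quotient.eq, ← pow_one Q]
      exact Ideal.pow_le_pow_right (by omega) (hσ.2 x)
    simp only [map_mul, map_pow, hσx, ← pow_add]
    have : ∀ i ∈ Finset.range N, (Ideal.Quotient.mk Q x) ^ (i + (N - 1 - i)) =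
        (Ideal.Quotient.mk Q x) ^ (N - 1) := fun i hi => by
      congr 1; have := Finset.mem_range.mp hi; omega
    rw [Finset.sum_congr rfl this, Finset.sum_const, Finset.card_range, nsmul_eq_mul,
      FiniteField.cast_card_eq_zero, zero_mul]
  set g := ∑ i ∈ Finset.range N, (σ • x) ^ i * x ^ (N - 1 - i) with hg_def
  have hdg : (σ • x - x) * g = σ • x ^ N - x ^ N := by
    rw [mul_comm, smul_pow', hg_def, geom_sum₂_mul]
  have he : σ • (x ^ N - x) - (x ^ N - x) ∈ Q ^ (m + 2) := hb _ hxN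
  have hkey : (σ • x - x) * (1 - g) ∈ Q ^ (m + 2) := by
    have : (σ • x - x) * (1 - g) = -(σ • (x ^ N - x) - (x ^ N - x)) := by
      rw [mul_sub, mul_one, hdg, smul_sub]; ring
    rw [this]
    exact neg_mem he
  rcases Ideal.IsPrime.mem_pow_mul Q hkey with h | h
  · exact h
  · exfalso
    apply (inferInstance : Q.IsMaximal).ne_top
    rw [Ideal.eq_top_iff_one]
    simpa using Ideal.add_mem _ h hg

/-- **Marcus, Ch. 4, Ex. 20.**  For `σ` in the inertia group `G_0` and `π ∈ Q \ Q²`: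
`σ ∈ G_m ↔ σ π ≡ π (mod Q^{m+1})`. [cite: Marcus2018, Ch. 4, Ex. 20 (p. 99)] -/
theorem mem_ramificationSubgroup_iff_smul_sub_mem [Finite (S ⧸ Q)] (hQ : Q ≠ ⊥) {π : S}
    (hπ : π ∈ Q) (hπ2 : π ∉ Q ^ 2) {σ : G} (hσ : σ ∈ Q.ramificationSubgroup G 0) (m : ℕ) :
    σ ∈ Q.ramificationSubgroup G m ↔ σ • π - π ∈ Q ^ (m + 1) := by
  induction m with
  | zero => exact ⟨fun h => h.2 π, fun _ => hσ⟩
  | succ m ih =>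
    refine ⟨fun h => h.2 π, fun h => ?_⟩
    have hm : σ ∈ Q.ramificationSubgroup G m := ih.mpr (Ideal.pow_le_pow_right (by omega) h)
    exact (mem_ramificationSubgroup_succ_iff hQ hπ hπ2 hm).mpr h

/-! ### The embedding `G_0 / G_1 ↪ κ(Q)ˣ` -/

/-- **Marcus, Ch. 4, Ex. 21: `G_0/G_1` embeds in `κ(Q)ˣ`.**  Let `Q ≠ 0` be a maximal ideal of
the Dedekind domain `S` with finite residue field `κ(Q) = S/Q`, acted on by `G`, and
`π ∈ Q \ Q²`.  There is a homomorphism `θ₀ : G_0 → κ(Q)ˣ`, `θ₀(σ) = ā` where `σ π ≡ a π (mod Q²)`,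
whose kernel is `G_1`. [cite: Marcus2018, Ch. 4, Ex. 21 (p. 99)] -/
theorem exists_monoidHom_ramificationSubgroup_zero_units [Finite (S ⧸ Q)] (hQ : Q ≠ ⊥) {π : S}
    (hπ : π ∈ Q) (hπ2 : π ∉ Q ^ 2) :
    ∃ θ : Q.ramificationSubgroup G 0 →* (S ⧸ Q)ˣ,
      (∀ (σ : Q.ramificationSubgroup G 0) (a : S), (σ : G) • π - a * π ∈ Q ^ 2 →
          ((θ σ : (S ⧸ Q)ˣ) : S ⧸ Q) = Ideal.Quotient.mk Q a) ∧
      θ.ker = (Q.ramificationSubgroup G 1).subgroupOf (Q.ramificationSubgroup G 0) := by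
  classical
  letI : Field (S ⧸ Q) := Ideal.Quotient.field Q
  -- the coefficient `a σ` with `σ π ≡ a σ π (mod Q²)`
  have hcoef : ∀ σ : Q.ramificationSubgroup G 0, ∃ a : S, (σ : G) • π - a * π ∈ Q ^ 2 := by
    intro σ
    have hσπ : (σ : G) • π ∈ Q ^ 1 := by
      rw [pow_one, show (σ : G) • π = ((σ : G) • π - π) + π by ring]
      exact add_mem (by simpa using σ.2.2 π) hπ
    simpa using exists_sub_mul_pow_mem_pow_succ hQ hπ hπ2 hσπ
  choose a ha using hcoef
  have hunique : ∀ (σ : Q.ramificationSubgroup G 0) (b : S),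
      (σ : G) • π - b * π ∈ Q ^ 2 → a σ - b ∈ Q := by
    intro σ b hb
    apply mem_of_mul_pow_mem_pow_succ hQ hπ hπ2 (k := 1)
    rw [show (a σ - b) * π ^ 1 = ((σ : G) • π - b * π) - ((σ : G) • π - a σ * π) by ring]
    exact sub_mem hb (ha σ)
  have hnot : ∀ σ : Q.ramificationSubgroup G 0, a σ ∉ Q := by
    intro σ haQ
    apply hπ2
    have h1 : (σ : G) • π ∈ Q ^ 2 := by
      rw [show (σ : G) • π = ((σ : G) • π - a σ * π) + a σ * π by ring]
      exact add_mem (ha σ) (by rw [pow_two]; exact Ideal.mul_mem_mul haQ hπ)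
    exact (smul_mem_pow_iff_of_smul_eq Q σ.2.1).mp h1
  have hne : ∀ σ : Q.ramificationSubgroup G 0, Ideal.Quotient.mk Q (a σ) ≠ 0 := fun σ => by
    simpa [Ideal.Quotient.eq_zero_iff_mem] using hnot σ
  -- multiplicativity of `σ ↦ a σ (mod Q)`
  have hmul : ∀ σ τ : Q.ramificationSubgroup G 0, a (σ * τ) - a σ * a τ ∈ Q := by
    intro σ τ
    apply hunique
    have e : ((σ * τ : Q.ramificationSubgroup G 0) : G) • π - a σ * a τ * π =
        ((σ : G) • a τ - a τ) * ((σ : G) • π) + a τ * ((σ : G) • π - a σ * π) +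
          (σ : G) • ((τ : G) • π - a τ * π) := by
      simp only [Subgroup.coe_mul, mul_smul, smul_sub, smul_mul']
      ring
    rw [e]
    refine add_mem (add_mem ?_ (Ideal.mul_mem_left _ _ (ha σ))) ?_
    · rw [pow_two]
      refine Ideal.mul_mem_mul (by simpa using σ.2.2 (a τ)) ?_
      rw [show (σ : G) • π = ((σ : G) • π - π) + π by ring]
      exact add_mem (by simpa using σ.2.2 π) hπ
    · exact (smul_mem_pow_iff_of_smul_eq Q σ.2.1).mpr (ha τ)
  let θ : Q.ramificationSubgroup G 0 →* (S ⧸ Q)ˣ :=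
    MonoidHom.mk' (fun σ => Units.mk0 (Ideal.Quotient.mk Q (a σ)) (hne σ)) fun σ τ => by
      ext
      simp only [Units.val_mk0, Units.val_mul, ← map_mul]
      exact (Ideal.Quotient.eq).mpr (hmul σ τ)
  refine ⟨θ, fun σ b hb => ?_, ?_⟩
  · change ((Units.mk0 (Ideal.Quotient.mk Q (a σ)) (hne σ) : (S ⧸ Q)ˣ) : S ⧸ Q) = _
    rw [Units.val_mk0]
    exact (Ideal.Quotient.eq).mpr (hunique σ b hb)
  · ext σ
    rw [MonoidHom.mem_ker, Subgroup.mem_subgroupOf, Units.ext_iff]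
    change ((Units.mk0 (Ideal.Quotient.mk Q (a σ)) (hne σ) : (S ⧸ Q)ˣ) : S ⧸ Q) = 1 ↔ _
    rw [Units.val_mk0, ← map_one (Ideal.Quotient.mk Q), Ideal.Quotient.eq,
      mem_ramificationSubgroup_iff_smul_sub_mem hQ hπ hπ2 σ.2 1]
    rw [show (1 : ℕ) + 1 = 2 from rfl]
    constructor
    · intro h
      rw [show (σ : G) • π - π = ((σ : G) • π - a σ * π) + (a σ - 1) * π by ring]
      refine add_mem (ha σ) ?_
      rw [pow_two]
      exact Ideal.mul_mem_mul h hπ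
    · intro h
      exact hunique σ 1 (by simpa using h)


/-! ### The embeddings `G_m / G_{m+1} ↪ (κ(Q), +)` for `m ≥ 1` -/

/-- **Marcus, Ch. 4, Ex. 22: `G_m/G_{m+1}` embeds in `(κ(Q), +)` for `m ≥ 1`.**  With `Q`, `π`
as above and `m ≥ 1` there is a homomorphism `θ_m : G_m → (S/Q, +)`, `θ_m(σ) = ā` where
`σ π ≡ π + a π^{m+1} (mod Q^{m+2})`, whose kernel is `G_{m+1}`.  (Marcus indexes this as
`V_{m-1}/V_m ↪ S/Q` for `m ≥ 2`.) [cite: Marcus2018, Ch. 4, Ex. 22 (p. 99)] -/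
theorem exists_monoidHom_ramificationSubgroup_multiplicative [Finite (S ⧸ Q)] (hQ : Q ≠ ⊥)
    {π : S} (hπ : π ∈ Q) (hπ2 : π ∉ Q ^ 2) {m : ℕ} (hm : 1 ≤ m) :
    ∃ θ : Q.ramificationSubgroup G m →* Multiplicative (S ⧸ Q),
      (∀ (σ : Q.ramificationSubgroup G m) (a : S),
          (σ : G) • π - π - a * π ^ (m + 1) ∈ Q ^ (m + 2) →
          θ σ = Multiplicative.ofAdd (Ideal.Quotient.mk Q a)) ∧
      θ.ker = (Q.ramificationSubgroup G (m + 1)).subgroupOf (Q.ramificationSubgroup G m) := by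
  classical
  have hσπ : ∀ σ : Q.ramificationSubgroup G m, (σ : G) • π ∈ Q := fun σ => by
    rw [show (σ : G) • π = ((σ : G) • π - π) + π by ring]
    exact add_mem (Ideal.pow_le_self (Nat.succ_ne_zero m) (σ.2.2 π)) hπ
  have hcoef : ∀ σ : Q.ramificationSubgroup G m,
      ∃ a : S, (σ : G) • π - π - a * π ^ (m + 1) ∈ Q ^ (m + 2) := fun σ =>
    exists_sub_mul_pow_mem_pow_succ hQ hπ hπ2 (σ.2.2 π)
  choose a ha using hcoef
  have hunique : ∀ (σ : Q.ramificationSubgroup G m) (b : S),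
      (σ : G) • π - π - b * π ^ (m + 1) ∈ Q ^ (m + 2) → a σ - b ∈ Q := by
    intro σ b hb
    apply mem_of_mul_pow_mem_pow_succ hQ hπ hπ2 (k := m + 1)
    rw [show (a σ - b) * π ^ (m + 1) = ((σ : G) • π - π - b * π ^ (m + 1)) -
      ((σ : G) • π - π - a σ * π ^ (m + 1)) by ring]
    exact sub_mem hb (ha σ)
  -- additivity of `σ ↦ a σ (mod Q)`; this is where `m ≥ 1` is used
  have hadd : ∀ σ τ : Q.ramificationSubgroup G m, a (σ * τ) - (a σ + a τ) ∈ Q := by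
    intro σ τ
    apply hunique
    have e : ((σ * τ : Q.ramificationSubgroup G m) : G) • π - π - (a σ + a τ) * π ^ (m + 1) =
        ((σ : G) • a τ - a τ) * ((σ : G) • π) ^ (m + 1) +
        a τ * (((σ : G) • π) ^ (m + 1) - π ^ (m + 1)) +
        (σ : G) • ((τ : G) • π - π - a τ * π ^ (m + 1)) +
        ((σ : G) • π - π - a σ * π ^ (m + 1)) := by
      simp only [Subgroup.coe_mul, mul_smul, smul_sub, smul_mul', smul_pow']
      ring
    rw [e]
    refine add_mem (add_mem (add_mem ?_ ?_) ?_) (ha σ)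
    · have h1 : ((σ : G) • a τ - a τ) * ((σ : G) • π) ^ (m + 1) ∈ Q ^ (m + 1) * Q ^ (m + 1) :=
        Ideal.mul_mem_mul (σ.2.2 (a τ)) (Ideal.pow_mem_pow (hσπ σ) (m + 1))
      rw [← pow_add] at h1
      exact Ideal.pow_le_pow_right (by omega) h1
    · have h2 : ((σ : G) • π) ^ (m + 1) - π ^ (m + 1) ∈ Q ^ (m + 2) := by
        rw [← geom_sum₂_mul]
        have hg : (∑ i ∈ Finset.range (m + 1), ((σ : G) • π) ^ i * π ^ (m + 1 - 1 - i)) ∈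
            Q ^ m := by
          refine Ideal.sum_mem _ fun i hi => ?_
          have hi' := Finset.mem_range.mp hi
          have h3 : ((σ : G) • π) ^ i * π ^ (m + 1 - 1 - i) ∈ Q ^ i * Q ^ (m + 1 - 1 - i) :=
            Ideal.mul_mem_mul (Ideal.pow_mem_pow (hσπ σ) i) (Ideal.pow_mem_pow hπ _)
          rw [← pow_add] at h3
          exact Ideal.pow_le_pow_right (by omega) h3
        have h4 : (∑ i ∈ Finset.range (m + 1), ((σ : G) • π) ^ i * π ^ (m + 1 - 1 - i)) *
            ((σ : G) • π - π) ∈ Q ^ m * Q ^ (m + 1) := Ideal.mul_mem_mul hg (σ.2.2 π)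
        rw [← pow_add] at h4
        exact Ideal.pow_le_pow_right (by omega) h4
      exact Ideal.mul_mem_left _ _ h2
    · exact (smul_mem_pow_iff_of_smul_eq Q σ.2.1).mpr (ha τ)
  let θ : Q.ramificationSubgroup G m →* Multiplicative (S ⧸ Q) :=
    MonoidHom.mk' (fun σ => Multiplicative.ofAdd (Ideal.Quotient.mk Q (a σ))) fun σ τ => by
      rw [← ofAdd_add, ← map_add]
      exact congrArg _ ((Ideal.Quotient.eq).mpr (hadd σ τ))
  refine ⟨θ, fun σ b hb => ?_, ?_⟩
  · change Multiplicative.ofAdd (Ideal.Quotient.mk Q (a σ)) = _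
    exact congrArg _ ((Ideal.Quotient.eq).mpr (hunique σ b hb))
  · ext σ
    rw [MonoidHom.mem_ker, Subgroup.mem_subgroupOf]
    change Multiplicative.ofAdd (Ideal.Quotient.mk Q (a σ)) = 1 ↔ _
    rw [ofAdd_eq_one, Ideal.Quotient.eq_zero_iff_mem,
      mem_ramificationSubgroup_succ_iff hQ hπ hπ2 σ.2]
    constructor
    · intro h
      rw [show (σ : G) • π - π = ((σ : G) • π - π - a σ * π ^ (m + 1)) + a σ * π ^ (m + 1)
        by ring]
      refine add_mem (ha σ) ?_
      rw [show m + 2 = (m + 1) + 1 from rfl, pow_succ' Q (m + 1)]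
      exact Ideal.mul_mem_mul h (Ideal.pow_mem_pow hπ _)
    · intro h
      simpa using hunique σ 0 (by simpa using h)

/-! ### Consequences for indices and orders -/

/-- **`[G_0 : G_1]` divides `#κ(Q) - 1`** (Marcus, Ch. 4, Ex. 21(c)): in particular it is prime to
the residue characteristic. [cite: Marcus2018, Ch. 4, Ex. 21(c) (p. 99)] -/
theorem relIndex_ramificationSubgroup_one_dvd [Finite (S ⧸ Q)] (hQ : Q ≠ ⊥) :
    (Q.ramificationSubgroup G 1).relIndex (Q.ramificationSubgroup G 0) ∣ Nat.card (S ⧸ Q) - 1 := by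
  classical
  letI : Field (S ⧸ Q) := Ideal.Quotient.field Q
  haveI : Fintype (S ⧸ Q) := Fintype.ofFinite _
  obtain ⟨π, hπ, hπ2⟩ := Ideal.exists_mem_pow_notMem_pow_succ Q hQ (IsMaximal.ne_top inferInstance) 1
  rw [pow_one] at hπ
  obtain ⟨θ, -, hker⟩ := exists_monoidHom_ramificationSubgroup_zero_units (G := G) hQ hπ hπ2
  rw [Subgroup.relIndex, ← hker, Subgroup.index_ker, Nat.card_eq_fintype_card (α := S ⧸ Q),
    ← Fintype.card_units, ← Nat.card_eq_fintype_card]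
  exact Subgroup.card_subgroup_dvd_card θ.range

/-- **`[G_m : G_{m+1}]` divides `#κ(Q)` for `m ≥ 1`** (Marcus, Ch. 4, Ex. 22(c)): in particular
it is a power of the residue characteristic. [cite: Marcus2018, Ch. 4, Ex. 22(c) (p. 99)] -/
theorem relIndex_ramificationSubgroup_succ_dvd [Finite (S ⧸ Q)] (hQ : Q ≠ ⊥) {m : ℕ}
    (hm : 1 ≤ m) :
    (Q.ramificationSubgroup G (m + 1)).relIndex (Q.ramificationSubgroup G m) ∣ Nat.card (S ⧸ Q) := by
  classical
  obtain ⟨π, hπ, hπ2⟩ := Ideal.exists_mem_pow_notMem_pow_succ Q hQ (IsMaximal.ne_top inferInstance) 1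
  rw [pow_one] at hπ
  obtain ⟨θ, -, hker⟩ :=
    exists_monoidHom_ramificationSubgroup_multiplicative (G := G) hQ hπ hπ2 hm
  rw [Subgroup.relIndex, ← hker, Subgroup.index_ker]
  exact Subgroup.card_subgroup_dvd_card θ.range

/-- For `m ≥ 1`, `p`-th powers (`p` the residue characteristic) drop one step in the
filtration: `σ ∈ G_m ⇒ σ ^ p ∈ G_{m+1}`, i.e. `G_m/G_{m+1}` is killed by `p`
(Marcus, Ch. 4, Ex. 22(c): "a direct sum of cyclic groups of order `p`").
[cite: Marcus2018, Ch. 4, Ex. 22(c) (p. 99)] -/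
theorem pow_ringChar_mem_ramificationSubgroup_succ [Finite (S ⧸ Q)] (hQ : Q ≠ ⊥) {m : ℕ}
    (hm : 1 ≤ m) {σ : G} (hσ : σ ∈ Q.ramificationSubgroup G m) :
    σ ^ ringChar (S ⧸ Q) ∈ Q.ramificationSubgroup G (m + 1) := by
  classical
  obtain ⟨π, hπ, hπ2⟩ := Ideal.exists_mem_pow_notMem_pow_succ Q hQ (IsMaximal.ne_top inferInstance) 1
  rw [pow_one] at hπ
  obtain ⟨θ, -, hker⟩ :=
    exists_monoidHom_ramificationSubgroup_multiplicative (G := G) hQ hπ hπ2 hm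
  have h : (⟨σ, hσ⟩ : Q.ramificationSubgroup G m) ^ ringChar (S ⧸ Q) ∈ θ.ker := by
    rw [MonoidHom.mem_ker, map_pow, ← ofAdd_toAdd (θ ⟨σ, hσ⟩), ← ofAdd_nsmul, nsmul_eq_mul,
      CharP.cast_eq_zero, zero_mul, ofAdd_zero]
  rw [hker, Subgroup.mem_subgroupOf] at h
  simpa using h

/-- `[G_0 : G_1]` is prime to the residue characteristic `p = char κ(Q)`
(Marcus, Ch. 4, Ex. 21(c) and 23). [cite: Marcus2018, Ch. 4, Ex. 21(c) (p. 99)] -/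
theorem relIndex_ramificationSubgroup_one_coprime_ringChar [Finite (S ⧸ Q)] (hQ : Q ≠ ⊥) :
    ((Q.ramificationSubgroup G 1).relIndex (Q.ramificationSubgroup G 0)).Coprime
      (ringChar (S ⧸ Q)) := by
  classical
  letI : Field (S ⧸ Q) := Ideal.Quotient.field Q
  haveI : Fintype (S ⧸ Q) := Fintype.ofFinite _
  obtain ⟨n, hp, hn⟩ := FiniteField.card (S ⧸ Q) (ringChar (S ⧸ Q))
  refine Nat.Coprime.coprime_dvd_left (relIndex_ramificationSubgroup_one_dvd (G := G) hQ) ?_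
  rw [Nat.card_eq_fintype_card, hn]
  refine ((Nat.Prime.coprime_iff_not_dvd hp).mpr fun h => hp.ne_one ?_).symm
  have h1 := Nat.dvd_sub (dvd_pow_self (ringChar (S ⧸ Q)) n.ne_zero) h
  rw [Nat.sub_sub_self (Nat.one_le_pow _ _ hp.pos)] at h1
  exact Nat.dvd_one.mp h1

/-! ### Abelian decomposition group: `[G_0 : G_1] ∣ #κ(𝔭) - 1` (Frobenius rationality of `θ₀`) -/

/-- **Marcus, Ch. 4, Ex. 26(c): if the decomposition group is abelian then `G_0/G_1` is cyclic
of order dividing `‖𝔭‖ - 1`.**  Let the finite group `G` act on the Dedekind domain `S` with ring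
of invariants `R` (`Algebra.IsInvariant R S G`), let `Q ≠ 0` be a maximal ideal of `S` with
finite residue field and `𝔭 = Q ∩ R`, and suppose every element of the decomposition group of
`Q` commutes with every element of the inertia group.  Then `[G_0 : G_1]` divides `#(R/𝔭) - 1`.
Proof: for a Frobenius `φ ∈ D_Q` (Mathlib `IsArithFrobAt.exists_of_isInvariant`) and `σ ∈ G_0`
with `σ π ≡ a π (mod Q²)`, applying `φ` and `φσ = σφ` gives `φ a ≡ a`, i.e. `a^{‖𝔭‖} ≡ a (mod Q)`;
so `θ₀(σ)^{‖𝔭‖-1} = 1`, and `θ₀(G_0) ≅ G_0/G_1` is a cyclic subgroup of `κ(Q)ˣ`.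
[cite: Marcus2018, Ch. 4, Ex. 26 (p. 100)] -/
theorem relIndex_ramificationSubgroup_one_dvd_of_commute {R : Type*} [CommRing R] [Algebra R S]
    [SMulCommClass G R S] [Finite G] [Algebra.IsInvariant R S G] [Finite (S ⧸ Q)] (hQ : Q ≠ ⊥)
    (hcomm : ∀ φ ∈ MulAction.stabilizer G Q, ∀ σ ∈ Q.inertia G, φ * σ = σ * φ) :
    (Q.ramificationSubgroup G 1).relIndex (Q.ramificationSubgroup G 0) ∣
      Nat.card (R ⧸ Q.under R) - 1 := by
  classical
  letI : Field (S ⧸ Q) := Ideal.Quotient.field Q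
  obtain ⟨π, hπ, hπ2⟩ := Ideal.exists_mem_pow_notMem_pow_succ Q hQ (IsMaximal.ne_top inferInstance) 1
  rw [pow_one] at hπ
  obtain ⟨θ, hθ, hker⟩ := exists_monoidHom_ramificationSubgroup_zero_units (G := G) hQ hπ hπ2
  -- a Frobenius element `φ`: `φ x ≡ x ^ q (mod Q)`, `q = #(R/𝔭)`
  obtain ⟨φ, hφ⟩ := IsArithFrobAt.exists_of_isInvariant R G Q
  set q := Nat.card (R ⧸ Q.under R) with hq
  have hφ' : ∀ x : S, φ • x - x ^ q ∈ Q := fun x => by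
    simpa [MulSemiringAction.toAlgHom_apply] using hφ x
  have hφQ : φ • Q = Q := hφ.mem_stabilizer
  -- `φ π ≡ b π (mod Q²)` with `b ∉ Q`
  obtain ⟨b, hb⟩ : ∃ b : S, φ • π - b * π ^ 1 ∈ Q ^ (1 + 1) :=
    exists_sub_mul_pow_mem_pow_succ hQ hπ hπ2
      (by rw [pow_one, ← hφQ]; exact Ideal.smul_mem_pointwise_smul _ _ _ hπ)
  rw [pow_one] at hb
  have hbQ : b ∉ Q := by
    intro hbQ
    apply hπ2
    have : φ • π ∈ Q ^ 2 := by
      rw [show φ • π = (φ • π - b * π) + b * π by ring]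
      exact add_mem hb (by rw [pow_two]; exact Ideal.mul_mem_mul hbQ hπ)
    exact (smul_mem_pow_iff_of_smul_eq Q hφQ).mp this
  -- every value of `θ` satisfies `x ^ (q - 1) = 1`
  have hpow : ∀ σ : Q.ramificationSubgroup G 0, θ σ ^ (q - 1) = 1 := by
    intro σ
    have hσI : (σ : G) ∈ Q.inertia G := by
      rw [← Ideal.ramificationSubgroup_zero]; exact σ.2
    have hσQ : (σ : G) • Q = Q := σ.2.1
    -- `σ π ≡ a π (mod Q²)`
    have hσπ : (σ : G) • π ∈ Q := by
      have h := Ideal.smul_mem_pointwise_smul (σ : G) _ _ hπ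
      rwa [hσQ] at h
    obtain ⟨a, ha⟩ : ∃ a : S, (σ : G) • π - a * π ^ 1 ∈ Q ^ (1 + 1) :=
      exists_sub_mul_pow_mem_pow_succ hQ hπ hπ2 (by rwa [pow_one])
    rw [pow_one] at ha
    have hθσ : ((θ σ : (S ⧸ Q)ˣ) : S ⧸ Q) = Ideal.Quotient.mk Q a := hθ σ a ha
    have haQ : a ∉ Q := by
      intro haQ
      apply (θ σ).ne_zero
      rw [hθσ, Ideal.Quotient.eq_zero_iff_mem]
      exact haQ
    -- apply `φ` to `σ π - a π ∈ Q²` and use `φ σ = σ φ`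
    have h1 : (σ : G) • (φ • π) - (φ • a) * (φ • π) ∈ Q ^ 2 := by
      have := (smul_mem_pow_iff_of_smul_eq Q hφQ (σ := φ)).mpr ha
      rwa [smul_sub, smul_mul', ← mul_smul, hcomm φ hφ.mem_stabilizer σ hσI, mul_smul] at this
    -- `σ (φ π) ≡ b a π` and `(φ a)(φ π) ≡ (φ a) b π (mod Q²)`
    have h2 : (σ : G) • (φ • π) - b * a * π ∈ Q ^ 2 := by
      have e : (σ : G) • (φ • π) - b * a * π = (σ : G) • (φ • π - b * π) +
          ((σ : G) • b - b) * ((σ : G) • π) + b * ((σ : G) • π - a * π) := by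
        rw [smul_sub, smul_mul']; ring
      rw [e]
      refine add_mem (add_mem ((smul_mem_pow_iff_of_smul_eq Q hσQ).mpr hb) ?_)
        (Ideal.mul_mem_left _ _ ha)
      rw [pow_two]
      exact Ideal.mul_mem_mul (hσI b) hσπ
    have h3 : (φ • a) * (φ • π) - (φ • a) * b * π ∈ Q ^ 2 := by
      rw [show (φ • a) * (φ • π) - (φ • a) * b * π = (φ • a) * (φ • π - b * π) by ring]
      exact Ideal.mul_mem_left _ _ hb
    have h4 : (b * (a - φ • a)) * π ^ 1 ∈ Q ^ (1 + 1) := by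
      have e : (b * (a - φ • a)) * π ^ 1 = ((σ : G) • (φ • π) - (φ • a) * (φ • π)) -
          ((σ : G) • (φ • π) - b * a * π) + ((φ • a) * (φ • π) - (φ • a) * b * π) := by ring
      rw [e]
      exact add_mem (sub_mem h1 h2) h3
    have h5 : a - φ • a ∈ Q :=
      ((inferInstance : Q.IsPrime).mem_or_mem
        (mem_of_mul_pow_mem_pow_succ hQ hπ hπ2 h4)).resolve_left hbQ
    -- hence `a ^ q ≡ a (mod Q)` and `θ σ ^ (q - 1) = 1`
    have h6 : Ideal.Quotient.mk Q a ^ q = Ideal.Quotient.mk Q a := by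
      rw [← map_pow, eq_comm, Ideal.Quotient.eq]
      have := add_mem h5 (hφ' a)
      rwa [sub_add_sub_cancel] at this
    have hq1 : 1 ≤ q := hφ.card_pos
    ext
    rw [Units.val_pow_eq_pow_val, hθσ, Units.val_one]
    have hne : Ideal.Quotient.mk Q a ≠ 0 := by
      rw [Ne, Ideal.Quotient.eq_zero_iff_mem]; exact haQ
    rw [← mul_left_inj' hne, ← pow_succ, Nat.sub_add_cancel hq1, h6, one_mul]
  -- `θ(G_0) ≅ G_0/G_1` is a cyclic subgroup of `κ(Q)ˣ` of exponent dividing `q - 1`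
  rw [Subgroup.relIndex, ← hker, Subgroup.index_ker, ← IsCyclic.exponent_eq_card]
  refine Monoid.exponent_dvd_of_forall_pow_eq_one fun x => ?_
  obtain ⟨σ, hσ⟩ := x.2
  exact Subtype.ext (by rw [Subgroup.coe_pow, Subgroup.coe_one, ← hσ]; exact hpow σ)

end Filtration

end Literature.NumberTheory.GaloisRepresentations
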